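import Summits.PneNP.PneNP.Theorems.OneSliceSliceACZeroDefs
import Summits.PneNP.PneNP.Theorems.OneSliceSliceACZeroSliceCoupling
import Summits.PneNP.PneNP.Theorems.OneSliceSliceACZeroBinomialHazard
import Summits.PneNP.PneNP.Theorems.OneSliceSliceACZeroAndCoin
import Summits.PneNP.PneNP.Theorems.OneSliceSliceACZeroInfluenceFourier
import Summits.PneNP.PneNP.Theorems.OneSliceSliceACZeroTalInfluence
import Summits.PneNP.PneNP.Theorems.OneSliceSliceACZeroWindow
import Literature.Computability.Complexity.CircuitRestriction
import Literature.Computability.Complexity.CircuitInputMap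
import Mathlib.Analysis.SpecialFunctions.Pow.Asymptotics
import Mathlib.Analysis.SpecialFunctions.Log.Basic

/-!
# Route OneSlice, crux `SliceACZero` (stmt-PneNP-2835) PROVED — line `russo-window-ladder`: the C⁺ `sliceIndist` and the transfer

Part 1 — slice/product indistinguishability for small bounded-depth circuits, assembled from the five landed stubs of the line:
* `hybrid_le` — `stub_sliceCoupling` + the binomial hazard estimate at `q = j/N`:
  `|E_{j/N} f − a_j f| ≤ (K₀/√j) · q · I_q(f)`;
* `biased_le` — `stub_andCoin` + an unbiased influence bound at depth `d+1` + `Circuit.exists_restrict` (the 0-restriction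
  `y ∧ ·` of an `acBasis` circuit is an `acBasis` circuit of size `≤ max |C| 1`, `acDepth ≤ max d 1`) + `Σ_y μ_{2q}(y) = 1`:
  `q · I_q(C) ≤ (K/2)(log(|C|+3))^B` for `0 ≤ q ≤ 1/2`;
* `biasedInfluence_comp_equiv` — the influence is invariant under renaming coordinates along `ι ≃ κ`; `boppana` — Boppana's
  total-influence bound for bounded-depth circuits on any finite index type (`stub_influenceFourier` + `stub_talInfluence`
  on `Fin N`, transported);
* `rate_eventually` — `M (log(j^c+3))^B/√j ≤ ε` for large `j`;
* `sliceIndist` — for `j ≥ j₀(d,c,ε)`, `2j ≤ N`: `|E_{μ_{j/N}}[C] − a_j(C)| ≤ ε` for every `acBasis` circuit `C` of `acDepth ≤ d`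
  and `≤ j^c` gates, on any finite cube (Filmus–Mossel-type invariance for AC⁰ tests; CLIQUE, `k`, `δ`, `Hyp` of the crux do not
  appear).
Part 2 — the crux `Summit.PneNP.PneNP.Theses.OneSlice.SliceACZero` (`Hyp → Conc`: descent of the fixed-δ, window-uniform
single-threshold average-case AC⁰ lower bound for k-CLIQUE from `G(n,q)` to every central slice `G(n,j)`), deciding theorem
`sliceACZero_proof`: given `Hyp` and `(d,c)` take `(k, δ_H)` from `Hyp d c`, answer with `k` and `δ := δ_H/2`; for large `n`, a central
`j` has `j ≥ j₀`, `n ≤ 5j`, `2j ≤ C(n,2)` (`window_eventually`, file `OneSliceSliceACZeroWindow.lean`); a circuit `C` over `acBasis` of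
`acDepth ≤ d`, `≤ n^c` gates and slice error `≤ δ·#slice_j` gives the test circuit `G = [C ≠ CLIQUE_k]` (`exists_xorClique_circuit`,
`acDepth ≤ d+4`, `≤ j^{2(c+k)+8}` gates by `size_bound`) with `a_j(G) = sliceErr/sliceCard ≤ δ_H/2`, so `sliceIndist` yields
`Pr_{G(n, j/C(n,2))}[C ≠ CLIQUE_k] ≤ δ_H`, and `Hyp` at `q = j/C(n,2) ∈ [0,1]` — whose window clause `|q·C(n,2) − m_k| ≤ m_k^{3/4}` is the
centrality clause verbatim — gives `n^c < |C|`. Read-back through the landed `…Theorems.SliceACZero.Negative.sliceACZero_iff`.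
Skeleton: `Cruxes/SliceACZero/Lines/russo-window-ladder.lean` (planner-cruxplan-stmt-PneNP-2835-russo-window-ladder-0, reshaped by the lead).
-/

noncomputable section

namespace Summit.PneNP.PneNP.Cruxes.SliceACZero.RussoWindowLadder

open scoped BigOperators
open Finset Filter Literature.Computability.Complexity
open Literature.Computability.Complexity.LowDegree (tailWeight)
open Literature.Probability.RandomGraphs.LowDegree (sgn)
open Summit.PneNP.PneNP.Theorems.SliceACZero.Negative (mk sliceCard sliceErr sliceACZero_iff)

set_option linter.dupNamespace false

/-! ### S1 + S2 ⇒ the hybrid inequality -/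

/-- **S1 + S2.** At the matched density `q = j/N` (`0 < j < N`): `|E_q f − a_j f| ≤ (K₀/√j)·q·I_q(f)`.
[folklore] -/
theorem hybrid_le {K₀ : ℝ}
    (h2 : ∀ (N j i : ℕ), 0 < j → j < N → i < N →
      hybridWeight N ((j : ℝ) / N) j i / (((N - i : ℕ) : ℝ) * (N.choose i : ℝ)) ≤
        K₀ / Real.sqrt j * (((j : ℝ) / N) ^ (i + 1) * (1 - (j : ℝ) / N) ^ (N - 1 - i)))
    {ι : Type} [Fintype ι] [DecidableEq ι] (f : (ι → Bool) → Bool) {j : ℕ} (hj0 : 0 < j)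
    (hjN : j < Fintype.card ι) :
    |prodAvg ((j : ℝ) / (Fintype.card ι : ℝ)) f - sliceAvg f j| ≤
      K₀ / Real.sqrt j * ((j : ℝ) / (Fintype.card ι : ℝ)) *
        biasedInfluence ((j : ℝ) / (Fintype.card ι : ℝ)) f := by
  have hNpos : (0 : ℝ) < (Fintype.card ι : ℝ) := by exact_mod_cast hj0.trans hjN
  have hq0 : 0 ≤ (j : ℝ) / (Fintype.card ι : ℝ) := div_nonneg (Nat.cast_nonneg _) hNpos.le
  have hq1 : (j : ℝ) / (Fintype.card ι : ℝ) ≤ 1 := by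
    rw [div_le_one hNpos]; exact_mod_cast hjN.le
  calc |prodAvg ((j : ℝ) / (Fintype.card ι : ℝ)) f - sliceAvg f j|
      ≤ ∑ p ∈ upPivotal f, hybridWeight (Fintype.card ι) ((j : ℝ) / (Fintype.card ι : ℝ)) j (wt p.1) /
          (((Fintype.card ι - wt p.1 : ℕ) : ℝ) * ((Fintype.card ι).choose (wt p.1) : ℝ)) :=
        stub_sliceCoupling ι f _ hq0 hq1 j hjN.le
    _ ≤ ∑ p ∈ upPivotal f, K₀ / Real.sqrt j *
          (((j : ℝ) / (Fintype.card ι : ℝ)) ^ (wt p.1 + 1) *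
            (1 - (j : ℝ) / (Fintype.card ι : ℝ)) ^ (Fintype.card ι - 1 - wt p.1)) :=
        Finset.sum_le_sum fun p hp => h2 (Fintype.card ι) j (wt p.1) hj0 hjN (wt_lt_card_of_mem_upPivotal hp)
    _ = K₀ / Real.sqrt j * ((j : ℝ) / (Fintype.card ι : ℝ)) *
          biasedInfluence ((j : ℝ) / (Fintype.card ι : ℝ)) f := by
        rw [biasedInfluence, Finset.mul_sum]
        refine Finset.sum_congr rfl fun p _ => ?_
        ring

/-! ### S3 + an unbiased bound ⇒ the biased influence budget -/

/-- **S3 + S4.** For `C` over `acBasis` of `acDepth ≤ d` and `0 ≤ q ≤ 1/2`: `q·I_q(C) ≤ (K/2)(log(|C|+3))^B`,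
where `(K, B)` are Boppana constants for depth `d+1` (restrictions may turn `C` into a one-gate constant). Uses
`Circuit.exists_restrict` (the 0-restriction `y ∧ ·` is a circuit of size `≤ max |C| 1`, `acDepth ≤ max d 1`) and
`Σ_y μ_{2q}(y) = 1`. [folklore] -/
theorem biased_le {d B : ℕ} {K : ℝ} (hK : 0 ≤ K)
    (h4 : ∀ (ι : Type) [Fintype ι] [DecidableEq ι] (C : Circuit ι), C.IsOver acBasis →
      C.acDepth ≤ d + 1 → biasedInfluence (1 / 2) C.eval ≤ K * Real.log ((C.size : ℝ) + 2) ^ B)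
    {ι : Type} [Fintype ι] [DecidableEq ι] (C : Circuit ι) (hC : C.IsOver acBasis)
    (hd : C.acDepth ≤ d) {q : ℝ} (hq0 : 0 ≤ q) (hq : 2 * q ≤ 1) :
    q * biasedInfluence q C.eval ≤ K / 2 * Real.log ((C.size : ℝ) + 3) ^ B := by
  have key : ∀ y : ι → Bool,
      biasedInfluence (1 / 2) (fun z => C.eval (fun i => y i && z i)) ≤
        K * Real.log ((C.size : ℝ) + 3) ^ B := by
    intro y
    obtain ⟨C', hB', hs', hd', he'⟩ :=
      C.exists_restrict hC (fun i => if y i = true then none else some false)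
    have hfun : (fun z => C.eval (fun i => y i && z i)) = C'.eval := by
      funext z
      rw [he']
      congr 1
      funext i
      cases hy : y i <;> simp [restrictInput, hy]
    rw [hfun]
    have hd1 : C'.acDepth ≤ d + 1 := hd'.trans (max_le (hd.trans (Nat.le_succ d)) (by omega))
    refine (h4 ι C' hB' hd1).trans ?_
    have hsz0 : (0 : ℝ) ≤ (C'.size : ℝ) := Nat.cast_nonneg _
    have hsz : (C'.size : ℝ) + 2 ≤ (C.size : ℝ) + 3 := by
      have h1 : C'.size ≤ C.size + 1 := hs'.trans (max_le (Nat.le_succ _) (by omega))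
      have h2 : (C'.size : ℝ) ≤ (C.size : ℝ) + 1 := by exact_mod_cast h1
      linarith
    exact mul_le_mul_of_nonneg_left
      (pow_le_pow_left₀ (Real.log_nonneg (by linarith)) (Real.log_le_log (by linarith) hsz) B) hK
  have hw0 : ∀ y : ι → Bool, 0 ≤ prodWeight (2 * q) y := fun y =>
    prodWeight_nonneg (by linarith) hq y
  have hsum : 2 * q * biasedInfluence q C.eval ≤ K * Real.log ((C.size : ℝ) + 3) ^ B := by
    rw [stub_andCoin ι C.eval q hq0 hq]
    calc ∑ y : ι → Bool, prodWeight (2 * q) y *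
          biasedInfluence (1 / 2) (fun z => C.eval (fun i => y i && z i))
        ≤ ∑ y : ι → Bool, prodWeight (2 * q) y * (K * Real.log ((C.size : ℝ) + 3) ^ B) :=
          Finset.sum_le_sum fun y _ => mul_le_mul_of_nonneg_left (key y) (hw0 y)
      _ = K * Real.log ((C.size : ℝ) + 3) ^ B := by
          rw [← Finset.sum_mul, sum_prodWeight, one_mul]
  linarith

/-! ### Index transport and Boppana's bound -/

section Transport

variable {ι κ : Type} [Fintype ι] [Fintype κ]

/-- The weight is invariant under renaming the coordinates along an equivalence. [folklore] -/
theorem wt_comp_equiv (e : ι ≃ κ) (x : ι → Bool) : wt (fun k => x (e.symm k)) = wt x := by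
  unfold wt
  rw [← Finset.card_map e.toEmbedding]
  congr 1
  ext k
  simp only [Finset.mem_filter, Finset.mem_univ, true_and, Finset.mem_map_equiv]

variable [DecidableEq ι] [DecidableEq κ]

/-- **Index transport.** The biased influence is invariant under renaming the coordinates along an equivalence
`e : ι ≃ κ` (the up-pivotal edges correspond under `(x, i) ↦ (x ∘ e⁻¹, e i)`, weights and `N` are preserved). [folklore] -/
theorem biasedInfluence_comp_equiv (e : ι ≃ κ) (q : ℝ) (g : (ι → Bool) → Bool) :
    biasedInfluence q (fun u : κ → Bool => g (fun i => u (e i))) = biasedInfluence q g := by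
  classical
  have hcard : Fintype.card κ = Fintype.card ι := Fintype.card_congr e.symm
  let ψ : (ι → Bool) × ι ≃ (κ → Bool) × κ := (e.arrowCongr (Equiv.refl Bool)).prodCongr e
  have hψ : ∀ p : (ι → Bool) × ι, ψ p = (fun k => p.1 (e.symm k), e p.2) := fun p => rfl
  have hupd : ∀ (x : ι → Bool) (i i' : ι),
      Function.update (fun k => x (e.symm k)) (e i) true (e i') = Function.update x i true i' := by
    intro x i i'
    rw [Function.update_apply_equiv_apply]
    simp [Function.comp_def]
  have hmem : ∀ p : (ι → Bool) × ι,
      p ∈ upPivotal g ↔ ψ p ∈ upPivotal (fun u : κ → Bool => g (fun i => u (e i))) := by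
    intro p
    rw [hψ]
    simp only [upPivotal, Finset.mem_filter, Finset.mem_univ, true_and, Equiv.symm_apply_apply, hupd]
  have hw : ∀ p : (ι → Bool) × ι, wt (ψ p).1 = wt p.1 := fun p => by rw [hψ]; exact wt_comp_equiv e p.1
  symm
  unfold biasedInfluence
  refine Finset.sum_equiv ψ hmem (fun p _ => ?_)
  rw [hw, hcard]

end Transport

/-- **Boppana's bound on any finite index type** (S4a + S4b + the index transport): for every depth `d` there are
`K, B` with `I[C] = biasedInfluence (1/2) C.eval ≤ K (log(|C|+2))^B` for every circuit `C` over `acBasis` of `acDepth ≤ d`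
on any finite `ι` — transport `C` to `Fin N` along `Fintype.equivFin ι` (`Circuit.mapInputs`: same size, basis, `acDepth`),
rewrite the influence by the Fourier formula (`stub_influenceFourier`) and bound the summed tails (`stub_talInfluence`).
(Boppana 1997 / Linial–Mansour–Nisan 1993; here any polylog.) [cite: Boppana1997, Theorem 1] -/
theorem boppana (d : ℕ) : ∃ K : ℝ, ∃ B : ℕ, ∀ (ι : Type) [Fintype ι] [DecidableEq ι] (C : Circuit ι),
    C.IsOver acBasis → C.acDepth ≤ d →
      biasedInfluence (1 / 2) C.eval ≤ K * Real.log ((C.size : ℝ) + 2) ^ B := by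
  obtain ⟨K, B, hKB⟩ := stub_talInfluence d
  refine ⟨K, B, fun ι _ _ C hC hd => ?_⟩
  set e := Fintype.equivFin ι with he
  have hev : (C.mapInputs e).eval = fun u => C.eval (fun i => u (e i)) := funext (Circuit.eval_mapInputs e C)
  have h1 : biasedInfluence (1 / 2) C.eval = biasedInfluence (1 / 2) (C.mapInputs e).eval := by
    rw [hev, biasedInfluence_comp_equiv e]
  have h2 : biasedInfluence (1 / 2) (C.mapInputs e).eval =
      ∑ k ∈ Finset.Icc 1 (Fintype.card ι), tailWeight (fun x => sgn ((C.mapInputs e).eval x)) k :=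
    stub_influenceFourier (Fintype.card ι) (C.mapInputs e).eval
  have h3 := hKB (Fintype.card ι) (C.mapInputs e) (hC.mapInputs e) (by simpa using hd)
  rw [Circuit.size_mapInputs] at h3
  rw [h1, h2]
  exact h3

/-! ### The rate `polylog(j)/√j → 0` -/

/-- For fixed `c, B` and `M ≥ 0`: `M·(log(j^c+3))^B/√j ≤ ε` for all large `j`. [folklore] -/
theorem rate_eventually (c B : ℕ) {M ε : ℝ} (hM : 0 ≤ M) (hε : 0 < ε) :
    ∃ j₀ : ℕ, 1 ≤ j₀ ∧ ∀ j : ℕ, j₀ ≤ j →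
      M * Real.log ((j : ℝ) ^ c + 3) ^ B / Real.sqrt j ≤ ε := by
  have hlo := isLittleO_log_rpow_rpow_atTop (B : ℝ) (by norm_num : (0 : ℝ) < 1 / 2)
  have ht : Tendsto (fun j : ℕ => Real.log (j : ℝ) ^ (B : ℝ) / (j : ℝ) ^ (1 / 2 : ℝ)) atTop (nhds 0) :=
    hlo.tendsto_div_nhds_zero.comp tendsto_natCast_atTop_atTop
  set L : ℝ := M * ((c : ℝ) + 2) ^ B + 1 with hL
  have hLpos : 0 < L := by rw [hL]; positivity
  have hε' : 0 < ε / L := div_pos hε hLpos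
  obtain ⟨j₁, hj₁⟩ := eventually_atTop.1 (ht.eventually (gt_mem_nhds hε'))
  refine ⟨max j₁ 2, le_max_of_le_right (by norm_num), fun j hj => ?_⟩
  have hj2 : 2 ≤ j := (le_max_right _ _).trans hj
  have hjr : (2 : ℝ) ≤ j := by exact_mod_cast hj2
  have hjpos : (0 : ℝ) < j := by linarith
  have hratio := hj₁ j ((le_max_left _ _).trans hj)
  rw [Real.rpow_natCast, ← Real.sqrt_eq_rpow] at hratio
  have hlogj : 0 ≤ Real.log j := Real.log_nonneg (by linarith)
  have hpow_le : (j : ℝ) ^ c + 3 ≤ (j : ℝ) ^ (c + 2) := by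
    have h1 : (1 : ℝ) ≤ (j : ℝ) ^ c := one_le_pow₀ (by linarith)
    have h2 : (j : ℝ) ^ (c + 2) = (j : ℝ) ^ c * ((j : ℝ) * j) := by ring
    have h3 : (4 : ℝ) ≤ (j : ℝ) * j := by nlinarith
    have h4 : (j : ℝ) ^ c * 4 ≤ (j : ℝ) ^ c * ((j : ℝ) * j) :=
      mul_le_mul_of_nonneg_left h3 (zero_le_one.trans h1)
    rw [h2]
    linarith
  have hlog_le : Real.log ((j : ℝ) ^ c + 3) ≤ ((c : ℝ) + 2) * Real.log j := by
    calc Real.log ((j : ℝ) ^ c + 3) ≤ Real.log ((j : ℝ) ^ (c + 2)) :=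
          Real.log_le_log (by positivity) hpow_le
      _ = ((c + 2 : ℕ) : ℝ) * Real.log j := Real.log_pow _ _
      _ = ((c : ℝ) + 2) * Real.log j := by push_cast; ring
  have hjc0 : (0 : ℝ) ≤ (j : ℝ) ^ c := by positivity
  have hlog0 : 0 ≤ Real.log ((j : ℝ) ^ c + 3) := Real.log_nonneg (by linarith)
  have hpowB : Real.log ((j : ℝ) ^ c + 3) ^ B ≤ ((c : ℝ) + 2) ^ B * Real.log j ^ B := by
    rw [← mul_pow]; exact pow_le_pow_left₀ hlog0 hlog_le B
  have hsqrt : 0 < Real.sqrt j := Real.sqrt_pos.2 hjpos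
  calc M * Real.log ((j : ℝ) ^ c + 3) ^ B / Real.sqrt j
      ≤ M * (((c : ℝ) + 2) ^ B * Real.log j ^ B) / Real.sqrt j :=
        div_le_div_of_nonneg_right (mul_le_mul_of_nonneg_left hpowB hM) hsqrt.le
    _ = (M * ((c : ℝ) + 2) ^ B) * (Real.log j ^ B / Real.sqrt j) := by ring
    _ ≤ L * (Real.log j ^ B / Real.sqrt j) :=
        mul_le_mul_of_nonneg_right (by rw [hL]; linarith) (div_nonneg (pow_nonneg hlogj _) hsqrt.le)
    _ ≤ L * (ε / L) := mul_le_mul_of_nonneg_left hratio.le hLpos.le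
    _ = ε := mul_div_cancel₀ ε hLpos.ne'

/-! ### The C⁺ -/

/-- **C⁺ of the line: slice/product indistinguishability for small bounded-depth circuits** on ANY finite cube — for
`j ≥ j₀(d,c,ε)` and `2j ≤ N`, an `acBasis` circuit of `acDepth ≤ d` with `≤ j^c` gates accepts the uniform point of slice `j`
and the `μ_{j/N}`-random point with probabilities within `ε`. With `K₀` from `stub_binomialHazard` and `(K, B)` from `boppana (d+1)`:
`|E_{j/N} C − a_j C| ≤ (K₀/√j)·q·I_q(C) ≤ K₀·(max K 0)/2 · (log(j^c+3))^B/√j ≤ ε` for `j ≥ j₀`. [folklore] -/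
theorem sliceIndist :
    ∀ (d c : ℕ) (ε : ℝ), 0 < ε → ∃ j₀ : ℕ, ∀ (ι : Type) [Fintype ι] [DecidableEq ι] (j : ℕ),
      j₀ ≤ j → 2 * j ≤ Fintype.card ι →
        ∀ C : Circuit ι, C.IsOver acBasis → C.acDepth ≤ d → C.size ≤ j ^ c →
          |prodAvg ((j : ℝ) / (Fintype.card ι : ℝ)) C.eval - sliceAvg C.eval j| ≤ ε := by
  intro d c ε hε
  obtain ⟨K₀, hK₀, h2'⟩ := stub_binomialHazard
  obtain ⟨K, B, h4'⟩ := boppana (d + 1)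
  have hK' : 0 ≤ max K 0 := le_max_right _ _
  have h4'' : ∀ (ι : Type) [Fintype ι] [DecidableEq ι] (C : Circuit ι), C.IsOver acBasis →
      C.acDepth ≤ d + 1 → biasedInfluence (1 / 2) C.eval ≤ max K 0 * Real.log ((C.size : ℝ) + 2) ^ B := by
    intro ι _ _ C hC hdC
    refine (h4' ι C hC hdC).trans (mul_le_mul_of_nonneg_right (le_max_left _ _) ?_)
    have : (0 : ℝ) ≤ (C.size : ℝ) := Nat.cast_nonneg _
    exact pow_nonneg (Real.log_nonneg (by linarith)) _
  obtain ⟨j₀, hj₀, hrate⟩ :=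
    rate_eventually c B (M := K₀ * (max K 0 / 2)) (mul_nonneg hK₀.le (div_nonneg hK' two_pos.le)) hε
  refine ⟨j₀, fun ι _ _ j hj h2j C hC hd hs => ?_⟩
  have hj1 : 0 < j := by omega
  have hjN : j < Fintype.card ι := by omega
  have hNpos : (0 : ℝ) < (Fintype.card ι : ℝ) := by exact_mod_cast hj1.trans hjN
  have hq0 : 0 ≤ (j : ℝ) / (Fintype.card ι : ℝ) := div_nonneg (Nat.cast_nonneg _) hNpos.le
  have hq2 : 2 * ((j : ℝ) / (Fintype.card ι : ℝ)) ≤ 1 := by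
    rw [mul_div_assoc', div_le_one hNpos]; exact_mod_cast h2j
  have hA := hybrid_le h2' C.eval hj1 hjN
  have hB := biased_le hK' h4'' C hC hd hq0 hq2
  have hsqrt : 0 ≤ K₀ / Real.sqrt j := div_nonneg hK₀.le (Real.sqrt_nonneg _)
  have hsize0 : (0 : ℝ) ≤ (C.size : ℝ) := Nat.cast_nonneg _
  have hsize : (C.size : ℝ) + 3 ≤ (j : ℝ) ^ c + 3 := by
    have : (C.size : ℝ) ≤ (j : ℝ) ^ c := by exact_mod_cast hs
    linarith
  calc |prodAvg ((j : ℝ) / (Fintype.card ι : ℝ)) C.eval - sliceAvg C.eval j|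
      ≤ K₀ / Real.sqrt j * ((j : ℝ) / (Fintype.card ι : ℝ)) *
          biasedInfluence ((j : ℝ) / (Fintype.card ι : ℝ)) C.eval := hA
    _ = K₀ / Real.sqrt j * (((j : ℝ) / (Fintype.card ι : ℝ)) *
          biasedInfluence ((j : ℝ) / (Fintype.card ι : ℝ)) C.eval) := by ring
    _ ≤ K₀ / Real.sqrt j * (max K 0 / 2 * Real.log ((C.size : ℝ) + 3) ^ B) :=
        mul_le_mul_of_nonneg_left hB hsqrt
    _ ≤ K₀ / Real.sqrt j * (max K 0 / 2 * Real.log ((j : ℝ) ^ c + 3) ^ B) := by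
        refine mul_le_mul_of_nonneg_left (mul_le_mul_of_nonneg_left ?_ (div_nonneg hK' two_pos.le)) hsqrt
        exact pow_le_pow_left₀ (Real.log_nonneg (by linarith)) (Real.log_le_log (by linarith) hsize) B
    _ = K₀ * (max K 0 / 2) * Real.log ((j : ℝ) ^ c + 3) ^ B / Real.sqrt j := by ring
    _ ≤ ε := hrate j hj


/-! ### The crux -/

/-- **The crux `SliceACZero` (`Hyp → Conc`) proved** — the transfer from the C⁺ `sliceIndist`. Given `Hyp` and `(d,c)`:
take `(k, δ_H)` from `Hyp d c`, answer with the same `k` and `δ := δ_H/2`; for large `n`, central `j` and `C` over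
`acBasis` of `acDepth ≤ d` with slice error `≤ δ·#slice_j`: either `n^c < |C|` outright, or the test circuit
`G = [C ≠ CLIQUE_k]` (`exists_xorClique_circuit`) has `≤ j^{2(c+k)+8}` gates (`window_eventually`, `size_bound`),
`a_j(G) ≤ δ_H/2` (`sliceAvg_edge_eq`), so `sliceIndist (d+4) (2(c+k)+8) (δ_H/2)` gives
`gnpDisagreeProb n (j/C(n,2)) C CLIQUE_k = E_{j/C(n,2)} G ≤ δ_H` (`prodAvg_edge_eq`), and `Hyp` at
`q = j/C(n,2) ∈ [0,1]` — window clause `|q·C(n,2) − m_k| = |j − m_k|` verbatim — yields `n^c < |C|`. [folklore] -/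
theorem sliceACZero_proof : Summit.PneNP.PneNP.Theses.OneSlice.SliceACZero := by
  rw [sliceACZero_iff]
  intro hH d c
  obtain ⟨k, hk3, δH, hδH, hHyp⟩ := hH d c
  refine ⟨k, hk3, δH / 2, half_pos hδH, ?_⟩
  obtain ⟨j₀, hj₀⟩ := sliceIndist (d + 4) (2 * (c + k) + 8) (δH / 2) (half_pos hδH)
  filter_upwards [hHyp, window_eventually hk3 (max j₀ 5), eventually_ge_atTop 2] with n hn hw hn2 j hj
    C hC hd herr
  obtain ⟨hjj₀, hnj, h2j⟩ := hw j hj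
  have hj₀j : j₀ ≤ j := (le_max_left _ _).trans hjj₀
  have hj5 : 5 ≤ j := (le_max_right _ _).trans hjj₀
  by_cases hbig : n ^ c < C.size
  · exact hbig
  have hs : C.size ≤ n ^ c := not_lt.1 hbig
  -- the test circuit and its size
  obtain ⟨G, hGB, hGd, hGs, hGe⟩ := exists_xorClique_circuit k C hC hd
  have hGsz : G.size ≤ j ^ (2 * (c + k) + 8) := hGs.trans (size_bound hn2 hj5 hnj hs)
  -- indistinguishability of slice `j` and `G(n, j/C(n,2))` for `G`
  have h2j' : 2 * j ≤ Fintype.card ((⊤ : SimpleGraph (Fin n)).edgeSet) := by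
    rw [card_edgeSet_top_fin]; exact h2j
  have key := hj₀ ((⊤ : SimpleGraph (Fin n)).edgeSet) j hj₀j h2j' G hGB hGd hGsz
  rw [card_edgeSet_top_fin, sliceAvg_edge_eq j hGe, prodAvg_edge_eq _ hGe] at key
  -- slice error ≤ δ_H/2, hence G(n,q)-error ≤ δ_H
  have hsl : (sliceErr n j C.eval (cliqueFn n k) : ℝ) / (sliceCard n j : ℝ) ≤ δH / 2 :=
    div_le_of_le_mul₀ (Nat.cast_nonneg _) (half_pos hδH).le herr
  have hgnp : gnpDisagreeProb n ((j : ℝ) / ((n.choose 2 : ℕ) : ℝ)) C.eval (cliqueFn n k) ≤ δH := by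
    have := (abs_sub_le_iff.1 key).1
    linarith
  -- fire `Hyp` at `q = j / C(n,2)`
  have hNpos : (0 : ℝ) < ((n.choose 2 : ℕ) : ℝ) := by exact_mod_cast (show 0 < n.choose 2 by omega)
  have hq0 : 0 ≤ (j : ℝ) / ((n.choose 2 : ℕ) : ℝ) := div_nonneg (Nat.cast_nonneg _) hNpos.le
  have hq1 : (j : ℝ) / ((n.choose 2 : ℕ) : ℝ) ≤ 1 := by
    rw [div_le_one hNpos]; exact_mod_cast (show j ≤ n.choose 2 by omega)
  have hqw : |(j : ℝ) / ((n.choose 2 : ℕ) : ℝ) * ((n.choose 2 : ℕ) : ℝ) - (mk n k : ℝ)| ≤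
      (mk n k : ℝ) ^ ((3 : ℝ) / 4) := by
    rw [div_mul_cancel₀ _ hNpos.ne']; exact hj
  exact hn _ hq0 hq1 hqw C hC hd hgnp

end Summit.PneNP.PneNP.Cruxes.SliceACZero.RussoWindowLadder

end
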